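import Literature.MathematicalPhysics.QuantumFieldTheory.BalabanImbrieJaffe1984to88.BIJ88MultiscaleDecay223
import Literature.MathematicalPhysics.QuantumFieldTheory.Balaban1983to89.B3TorusRadialSums

/-!
# `BalabanImbrieJaffe1984to88.BIJ88MultiscaleDecay223Torus` — T. Bałaban, J. Imbrie, A. Jaffe, *Effective action and cluster properties of
the abelian Higgs model*, Commun. Math. Phys. **114** (1988) 257–315 [BalabanImbrieJaffe1988]: the hence-steps of `BIJ88MultiscaleDecay223`
((2.13) operator decay, the kernel composition behind *"derives its regularity and decay from that of C^{(j)}_{loc} and H_{k,loc}"*) ON THE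
TORI OF RECORD `Balaban1983to89.Site P j` with the `ℓ¹` torus distance `Site.tdist` — the row-sum and triangle-inequality hypotheses of
the abstract file DISCHARGED by p20's lattice-sum toolkit `B3TorusRadialSums.sum_exp_neg_tdist_le` (constant `(2(1 + a⁻¹))^d`, uniform
in the size of the torus)

statement-level skeleton of published theorems with citation tags; proofs where landed; nothing here is a claim about the Yang–Mills mass gap

PDF held: `paper:balaban1988-cmp114-bij-abelian-higgs-effective-action` (journal page = PDF page + 256); p. 261 [PDF 5] (render in the seat
folder `renders/bij88-p005.png`).

WHAT IS REPRODUCED.  SKELETON rows **C2.Eq2.13** / **C2.Eq2.23** — the MODEL INSTANCE on the cell's carriers of record of the abstract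
hence-steps landed in `BIJ88MultiscaleDecay223` (p249538): cell `lit-balaban`, HOME `run/shared/lean/pub/lit-balaban/`; Phase-2 seat p08
gen 4 = unit `lit-balaban-p08` (fourth file of the generation); owner r18, referee ref-5.  p. 261, verbatim: *"This propagator derives its
regularity and decay from that of C^{(j)}_{loc} and H_{k,loc}. Thus |(𝒟_{k,loc}f)(b)| ≦ ce^{−c dist(suppt f,b)}‖f‖_∞, (2.13)"*.

WHAT IS PROVED HERE (0 `sorry`, standard axioms; theorems only).  §1 on `Site P j` with `dist(x,y) = tdist x y` (lattice steps):
`sum_exp_neg_tdist_le'` (row sums `Σ_y e^{−a·tdist(y,x)} ≤ (2(1+a⁻¹))^d`, p20's bound read with the summation variable first);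
**`abs_sum_mul_le_comp_torus`** (composition of two kernels decaying in `tdist` at rate δ > 0: `|Σ_yK(x,y)M(y,z)| ≤ AB(2(1+(δ/2)⁻¹))^d
e^{−(δ/2)tdist(x,z)}`, no hypotheses beyond the two kernel bounds — triangle inequality and row sum supplied);
**`opDecay213_torus`** / **`opDecay213_torus_typed`** ((2.13) for a hierarchical family of site kernels `T_n` with per-scale bounds
`|T_n(x,y)| ≤ AΛⁿe^{−δLⁿtdist(y,x)}`, `Λ < 1`, `δ > 0`: `|(Σ_nT_n f)(x)| ≤ (A/(1−Λ))(2(1+(δ/2)⁻¹))^d·e^{−(δ/2)dist(suppt f,x)}‖f‖_∞` for every x,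
and r18's one-letter `OpDecay` under the explicit compatibility).  §2 output on the bonds `PBond P j` located at their source (the convention
of `Setup.KernelExpDecay`): `sum_bond_exp_neg_tdist_le` (bond row sums `≤ d(2(1+a⁻¹))^d`), **`abs_sum_mul_le_comp_torus_bond`**,
**`kernelExpDecay_comp`** (the cell's own predicate `Setup.KernelExpDecay` is closed under composition: constants `(C₁, δ₀, s)`, `(C₂, δ₀, s)`,
`δ₀s > 0` ⟹ `(C₁C₂·d(2(1+(δ₀s/2)⁻¹))^d, δ₀/2, s)`, uniform in the volume), **`opDecay213_torus_bond`** / **`opDecay213_torus_bond_typed`**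
(the printed `(𝒟_{k,loc}f)(b)`, `f` on sites, `b` a bond: `OpDecay (fun y b => tdist y b.src) (Σ_nT_n) c`).
§3 (v1.1, seat p08 gen 5; append-only): `Setup.KernelExpDecay` for HIERARCHICAL families with per-scale constants `(AΛⁿ, δ₀Lⁿ, s)` —
`kernelExpDecay_one_iff_decay` (dictionary with r18's one-letter `Decay`), `kernelExpDecay_mono`, `kernelExpDecay_sum`/`_add` (common rate,
prefactors add), **`kernelExpDecay_multiscale`** (`Λ < 1` ⟹ `Σ_{n<N}G_n` is `KernelExpDecay (A/(1−Λ)) δ₀ s` for every `N`: the (2.12)–(2.13)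
regime), **`abs_multiscale_le_far`** (any `Λ ≥ 0`, one-step ratio `Λe^{−δ₀s(L−1)d₀} ≤ q < 1` ⟹ `|Σ_{n<N}G_n(b,b′)| ≤ (A/(1−q))e^{−δ₀s·tdist}`
beyond the threshold `d₀`: the (2.16)/(2.23) regime, p. 262 *"the rapid decay of terms with small j controls the scalings and the sum over j"*).
HONEST SCOPE.  Distances in lattice steps of the scale-`j` carrier (the papers' `|x − y|` = spacing · `tdist`, cf. `Setup` DIVERGENCE F2;
`KernelExpDecay` carries the spacing `s` explicitly); a bond is located at its source (target/midpoint conventions differ by ≤ 1 step, absorbed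
in the constants — not spelled out); the per-scale kernel estimates remain displayed hypotheses as in `BIJ88MultiscaleDecay223`.  NOT summit
progress.
-/

namespace Literature.MathematicalPhysics.QuantumFieldTheory.BalabanImbrieJaffe1984to88.BIJ88MultiscaleDecay223Torus

open Finset BIJ88Sect2Statements BIJ88Close235Proof BIJ88OpDecay230Proof BIJ88MultiscaleDecay223
open Literature.MathematicalPhysics.QuantumFieldTheory.Balaban1983to89
open Literature.MathematicalPhysics.QuantumFieldTheory.Balaban1983to89.B3TorusRadialSums

noncomputable section

variable {P : Params} {j : ℕ}

/-! ## 1. Site carriers: kernels `Site P j → Site P j → ℝ`, distance `tdist` in lattice steps -/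

/-- kernel: the `ℓ¹` torus distance is symmetric. [folklore] -/
private theorem tdist_comm' (x y : Site P j) : Site.tdist x y = Site.tdist y x := by
  simp only [Site.tdist, min_comm]

/-- kernel: subadditivity of the circular size `min(val a, val(−a))` on `ℤ/N` (the private lemma of `BIJ85Ineq724Proof` §4, seat p03
gen 2, copied). [folklore] -/
private theorem circ_add_le' {N : ℕ} [NeZero N] (a b : ZMod N) :
    min (a + b).val (-(a + b)).val ≤ min a.val (-a).val + min b.val (-b).val := by
  rcases le_total a.val (-a).val with ha | ha <;> rcases le_total b.val (-b).val with hb | hb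
  · rw [min_eq_left ha, min_eq_left hb]
    exact (min_le_left _ _).trans (ZMod.val_add_le a b)
  · rw [min_eq_left ha, min_eq_right hb]
    rcases le_total (-b).val a.val with h | h
    · have e : a + b = a - -b := by ring
      calc min (a + b).val (-(a + b)).val ≤ (a + b).val := min_le_left _ _
        _ = a.val - (-b).val := by rw [e, ZMod.val_sub h]
        _ ≤ a.val + (-b).val := by omega
    · have e : -(a + b) = -b - a := by ring
      calc min (a + b).val (-(a + b)).val ≤ (-(a + b)).val := min_le_right _ _
        _ = (-b).val - a.val := by rw [e, ZMod.val_sub h]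
        _ ≤ a.val + (-b).val := by omega
  · rw [min_eq_right ha, min_eq_left hb]
    rcases le_total (-a).val b.val with h | h
    · have e : a + b = b - -a := by ring
      calc min (a + b).val (-(a + b)).val ≤ (a + b).val := min_le_left _ _
        _ = b.val - (-a).val := by rw [e, ZMod.val_sub h]
        _ ≤ (-a).val + b.val := by omega
    · have e : -(a + b) = -a - b := by ring
      calc min (a + b).val (-(a + b)).val ≤ (-(a + b)).val := min_le_right _ _
        _ = (-a).val - b.val := by rw [e, ZMod.val_sub h]
        _ ≤ (-a).val + b.val := by omega
  · rw [min_eq_right ha, min_eq_right hb]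
    have e : -(a + b) = -a + -b := by ring
    calc min (a + b).val (-(a + b)).val ≤ (-(a + b)).val := min_le_right _ _
      _ ≤ (-a).val + (-b).val := by rw [e]; exact ZMod.val_add_le _ _

/-- kernel: triangle inequality for the `ℓ¹` torus distance `Site.tdist` (lattice steps; the private lemma of `BIJ85Ineq724Proof` §4,
copied). [folklore] -/
private theorem tdist_triangle' (x y z : Site P j) : Site.tdist x z ≤ Site.tdist x y + Site.tdist y z := by
  unfold Site.tdist
  rw [← Finset.sum_add_distrib]
  refine Finset.sum_le_sum fun μ _ => ?_
  have e1 : x μ - z μ = (x μ - y μ) + (y μ - z μ) := by ring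
  have e2 : z μ - x μ = -((x μ - y μ) + (y μ - z μ)) := by ring
  have e3 : y μ - x μ = -(x μ - y μ) := by ring
  have e4 : z μ - y μ = -(y μ - z μ) := by ring
  rw [e1, e2, e3, e4]
  exact circ_add_le' _ _

/-- p20's uniform lattice-sum bound read with the summation variable in the first slot: `Σ_y e^{−a·tdist(y,x)} ≤ (2(1+a⁻¹))^d` for `a > 0`.
[cite: BalabanImbrieJaffe1988, (2.13) p.261] -/
theorem sum_exp_neg_tdist_le' {a : ℝ} (ha : 0 < a) (x : Site P j) :
    ∑ y : Site P j, Real.exp (-a * (Site.tdist y x : ℝ)) ≤ (2 * (1 + a⁻¹)) ^ P.d := by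
  have h := sum_exp_neg_tdist_le (P := P) (j := j) ha x
  refine le_trans (le_of_eq (Finset.sum_congr rfl fun y _ => ?_)) h
  rw [tdist_comm' y x, neg_mul]

/-- **Kernel composition on the torus** (the hence behind *"derives its regularity and decay from that of C^{(j)}_{loc} and H_{k,loc}"*, site
kernels, `δ > 0`): `|K(x,y)| ≤ Ae^{−δ tdist(x,y)}` and `|M(y,z)| ≤ Be^{−δ tdist(y,z)}` give `|Σ_y K(x,y)M(y,z)| ≤ AB(2(1+(δ/2)⁻¹))^d·e^{−(δ/2)tdist(x,z)}`
— `BIJ88MultiscaleDecay223.abs_sum_mul_le_comp` with the triangle inequality and the row sum of the torus supplied.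
[cite: BalabanImbrieJaffe1988, (2.13) p.261] -/
theorem abs_sum_mul_le_comp_torus {K M : Site P j → Site P j → ℝ} {A B δ : ℝ} (hA : 0 ≤ A) (hB : 0 ≤ B) (hδ : 0 < δ)
    (hK : ∀ x y, |K x y| ≤ A * Real.exp (-δ * (Site.tdist x y : ℝ)))
    (hM : ∀ y z, |M y z| ≤ B * Real.exp (-δ * (Site.tdist y z : ℝ))) (x z : Site P j) :
    |∑ y, K x y * M y z| ≤ A * B * (2 * (1 + (δ / 2)⁻¹)) ^ P.d * Real.exp (-(δ / 2) * (Site.tdist x z : ℝ)) := by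
  refine abs_sum_mul_le_comp (ρ₁ := fun x y => (Site.tdist x y : ℝ)) (ρ₂ := fun y z => (Site.tdist y z : ℝ))
    (ρ := fun x z => (Site.tdist x z : ℝ)) hA hB hδ.le (fun _ _ => by positivity) (fun x y z => ?_) hK hM (fun x => ?_) x z
  · exact_mod_cast tdist_triangle' x y z
  · have h := sum_exp_neg_tdist_le (P := P) (j := j) (half_pos hδ) x
    refine le_trans (le_of_eq (Finset.sum_congr rfl fun y _ => ?_)) h
    rw [neg_mul]

/-- **(2.13) on the torus, two explicit constants**: a hierarchical family of site kernels `T_n` (output x, input y) with per-scale bounds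
`|T_n(x,y)| ≤ AΛⁿe^{−δLⁿ tdist(y,x)}`, scaling factors `Λ < 1` and `δ > 0`: for every `N`, `f`, `x`,
`|(Σ_{n<N}T_n f)(x)| ≤ (A/(1−Λ))·(2(1+(δ/2)⁻¹))^d·e^{−(δ/2)dist(suppt f,x)}‖f‖_∞` — `BIJ88MultiscaleDecay223.opDecay213` with the torus row sum.
[cite: BalabanImbrieJaffe1988, (2.13) p.261] -/
theorem opDecay213_torus {T : ℕ → Site P j → Site P j → ℝ} {L Λ δ A : ℝ} (hL : 1 ≤ L) (hΛ : 0 ≤ Λ) (hΛ1 : Λ < 1)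
    (hδ : 0 < δ) (hA : 0 ≤ A)
    (hT : ∀ n x y, |T n x y| ≤ A * Λ ^ n * Real.exp (-(δ * L ^ n) * (Site.tdist y x : ℝ))) (N : ℕ) (f : Site P j → ℝ)
    (x : Site P j) :
    |applyK (fun x y => ∑ n ∈ range N, T n x y) f x|
      ≤ A / (1 - Λ) * (2 * (1 + (δ / 2)⁻¹)) ^ P.d
        * Real.exp (-(δ / 2) * suppDist (fun y x => (Site.tdist y x : ℝ)) f x) * supNorm f :=
  opDecay213 (dist := fun y x => (Site.tdist y x : ℝ)) hL hΛ hΛ1 hδ.le hA (fun _ _ => by positivity) hT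
    (fun x => sum_exp_neg_tdist_le' (half_pos hδ) x) N f x

/-- **(2.13) on the torus, THE TYPED ROW** `BIJ88Sect2Statements.OpDecay (tdist) 𝒟_{k,loc} c` for the hierarchical site-kernel family, for any
`c` with `(A/(1−Λ))(2(1+(δ/2)⁻¹))^d ≤ c ≤ δ/2`. [cite: BalabanImbrieJaffe1988, (2.13) p.261] -/
theorem opDecay213_torus_typed {T : ℕ → Site P j → Site P j → ℝ} {L Λ δ A c : ℝ} (hL : 1 ≤ L) (hΛ : 0 ≤ Λ) (hΛ1 : Λ < 1)
    (hδ : 0 < δ) (hA : 0 ≤ A)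
    (hT : ∀ n x y, |T n x y| ≤ A * Λ ^ n * Real.exp (-(δ * L ^ n) * (Site.tdist y x : ℝ)))
    (hlow : A / (1 - Λ) * (2 * (1 + (δ / 2)⁻¹)) ^ P.d ≤ c) (hhigh : c ≤ δ / 2) (N : ℕ) :
    OpDecay (fun y x => (Site.tdist y x : ℝ)) (fun x y => ∑ n ∈ range N, T n x y) c :=
  opDecay213_typed (dist := fun y x => (Site.tdist y x : ℝ)) hL hΛ hΛ1 hδ.le hA (fun _ _ => by positivity) hT
    (fun x => sum_exp_neg_tdist_le' (half_pos hδ) x) hlow hhigh N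

/-! ## 2. Bond carriers: output on the bonds `PBond P j` (located at their source, the convention of `Setup.KernelExpDecay`) -/

/-- Row sums over the positively oriented bonds, bond located at its source: `Σ_{b′} e^{−a·tdist(x, b′.src)} ≤ d·(2(1+a⁻¹))^d` (`a > 0`;
d directions per site). [cite: BalabanImbrieJaffe1988, (2.13) p.261] -/
theorem sum_bond_exp_neg_tdist_le {a : ℝ} (ha : 0 < a) (x : Site P j) :
    ∑ b : PBond P j, Real.exp (-a * (Site.tdist x b.src : ℝ)) ≤ P.d * (2 * (1 + a⁻¹)) ^ P.d := by
  calc ∑ b : PBond P j, Real.exp (-a * (Site.tdist x b.src : ℝ))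
      = ∑ p : Site P j × Fin P.d, Real.exp (-a * (Site.tdist x p.1 : ℝ)) := by
        rw [← Equiv.sum_comp (LatticeFieldCalculus.bondEquiv (P := P) (j := j))]; rfl
    _ = ∑ y : Site P j, (P.d : ℝ) * Real.exp (-a * (Site.tdist x y : ℝ)) := by
        rw [Fintype.sum_prod_type]
        simp [Finset.sum_const, Finset.card_univ, Fintype.card_fin]
    _ ≤ P.d * (2 * (1 + a⁻¹)) ^ P.d := by
        rw [← Finset.mul_sum]
        refine mul_le_mul_of_nonneg_left ?_ (Nat.cast_nonneg _)
        have h := sum_exp_neg_tdist_le (P := P) (j := j) ha x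
        refine le_trans (le_of_eq (Finset.sum_congr rfl fun y _ => ?_)) h
        rw [neg_mul]

/-- **Composition of two bond kernels on the torus** (`δ > 0`, bonds at their sources): `|K(b,b′)| ≤ Ae^{−δ tdist(b.src,b′.src)}`,
`|M(b′,b″)| ≤ Be^{−δ tdist(b′.src,b″.src)}` ⟹ `|Σ_{b′}K(b,b′)M(b′,b″)| ≤ AB·d(2(1+(δ/2)⁻¹))^d·e^{−(δ/2)tdist(b.src,b″.src)}`.
[cite: BalabanImbrieJaffe1988, (2.13) p.261] -/
theorem abs_sum_mul_le_comp_torus_bond {K M : PBond P j → PBond P j → ℝ} {A B δ : ℝ} (hA : 0 ≤ A) (hB : 0 ≤ B) (hδ : 0 < δ)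
    (hK : ∀ b b', |K b b'| ≤ A * Real.exp (-δ * (Site.tdist b.src b'.src : ℝ)))
    (hM : ∀ b' b'', |M b' b''| ≤ B * Real.exp (-δ * (Site.tdist b'.src b''.src : ℝ))) (b b'' : PBond P j) :
    |∑ b', K b b' * M b' b''|
      ≤ A * B * (P.d * (2 * (1 + (δ / 2)⁻¹)) ^ P.d) * Real.exp (-(δ / 2) * (Site.tdist b.src b''.src : ℝ)) := by
  refine abs_sum_mul_le_comp (ρ₁ := fun b b' : PBond P j => (Site.tdist b.src b'.src : ℝ))
    (ρ₂ := fun b' b'' : PBond P j => (Site.tdist b'.src b''.src : ℝ)) (ρ := fun b b'' : PBond P j => (Site.tdist b.src b''.src : ℝ))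
    hA hB hδ.le (fun _ _ => by positivity) (fun b b' b'' => ?_) hK hM (fun b => sum_bond_exp_neg_tdist_le (half_pos hδ) b.src) b b''
  exact_mod_cast tdist_triangle' b.src b'.src b''.src

/-- **The cell's own decay predicate is closed under composition**: two `Setup.KernelExpDecay` bond kernels with constants `(C₁, δ₀, s)`,
`(C₂, δ₀, s)` (`δ₀s > 0`) compose to a `KernelExpDecay` kernel with constants `(C₁C₂·d(2(1+(δ₀s/2)⁻¹))^d, δ₀/2, s)` — uniform in the
volume, as every *"product of exponentially decaying operators"* step of the series uses. [cite: BalabanImbrieJaffe1988, (2.13) p.261] -/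
theorem kernelExpDecay_comp {G₁ G₂ : BondKernel P j} {C₁ C₂ δ₀ s : ℝ} (hC₁ : 0 ≤ C₁) (hC₂ : 0 ≤ C₂) (hδs : 0 < δ₀ * s)
    (h₁ : KernelExpDecay G₁ C₁ δ₀ s) (h₂ : KernelExpDecay G₂ C₂ δ₀ s) :
    KernelExpDecay (fun b b'' => ∑ b', G₁ b b' * G₂ b' b'') (C₁ * C₂ * (P.d * (2 * (1 + (δ₀ * s / 2)⁻¹)) ^ P.d)) (δ₀ / 2) s := by
  intro b b''
  have hK : ∀ b b' : PBond P j, |G₁ b b'| ≤ C₁ * Real.exp (-(δ₀ * s) * (Site.tdist b.src b'.src : ℝ)) := fun b b' => by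
    rw [← neg_mul]; exact h₁ b b'
  have hM : ∀ b' b'' : PBond P j, |G₂ b' b''| ≤ C₂ * Real.exp (-(δ₀ * s) * (Site.tdist b'.src b''.src : ℝ)) := fun b' b'' => by
    rw [← neg_mul]; exact h₂ b' b''
  have e : -(δ₀ / 2) * s * (Site.tdist b.src b''.src : ℝ) = -(δ₀ * s / 2) * (Site.tdist b.src b''.src : ℝ) := by ring
  rw [e]
  exact abs_sum_mul_le_comp_torus_bond hC₁ hC₂ hδs hK hM b b''

/-- **(2.13) on the torus WITH OUTPUT ON BONDS** (the printed `(𝒟_{k,loc}f)(b)`: `f` a site function, `b` a bond of `T₁^{(k)}` located at its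
source), two explicit constants: per-scale bounds `|T_n(b,y)| ≤ AΛⁿe^{−δLⁿ tdist(y,b.src)}`, `Λ < 1`, `δ > 0` ⟹
`|(Σ_{n<N}T_n f)(b)| ≤ (A/(1−Λ))(2(1+(δ/2)⁻¹))^d·e^{−(δ/2)dist(suppt f,b)}‖f‖_∞`. [cite: BalabanImbrieJaffe1988, (2.13) p.261] -/
theorem opDecay213_torus_bond {T : ℕ → PBond P j → Site P j → ℝ} {L Λ δ A : ℝ} (hL : 1 ≤ L) (hΛ : 0 ≤ Λ) (hΛ1 : Λ < 1)
    (hδ : 0 < δ) (hA : 0 ≤ A)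
    (hT : ∀ n b y, |T n b y| ≤ A * Λ ^ n * Real.exp (-(δ * L ^ n) * (Site.tdist y b.src : ℝ))) (N : ℕ) (f : Site P j → ℝ)
    (b : PBond P j) :
    |applyK (fun b y => ∑ n ∈ range N, T n b y) f b|
      ≤ A / (1 - Λ) * (2 * (1 + (δ / 2)⁻¹)) ^ P.d
        * Real.exp (-(δ / 2) * suppDist (fun y (b : PBond P j) => (Site.tdist y b.src : ℝ)) f b) * supNorm f :=
  opDecay213 (dist := fun y (b : PBond P j) => (Site.tdist y b.src : ℝ)) hL hΛ hΛ1 hδ.le hA (fun _ _ => by positivity) hT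
    (fun b => sum_exp_neg_tdist_le' (half_pos hδ) b.src) N f b

/-- **(2.13) on the torus with output on bonds, THE TYPED ROW** `BIJ88Sect2Statements.OpDecay (fun y b => tdist y b.src) 𝒟_{k,loc} c` for the
hierarchical family, any `c` with `(A/(1−Λ))(2(1+(δ/2)⁻¹))^d ≤ c ≤ δ/2`. [cite: BalabanImbrieJaffe1988, (2.13) p.261] -/
theorem opDecay213_torus_bond_typed {T : ℕ → PBond P j → Site P j → ℝ} {L Λ δ A c : ℝ} (hL : 1 ≤ L) (hΛ : 0 ≤ Λ) (hΛ1 : Λ < 1)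
    (hδ : 0 < δ) (hA : 0 ≤ A)
    (hT : ∀ n b y, |T n b y| ≤ A * Λ ^ n * Real.exp (-(δ * L ^ n) * (Site.tdist y b.src : ℝ)))
    (hlow : A / (1 - Λ) * (2 * (1 + (δ / 2)⁻¹)) ^ P.d ≤ c) (hhigh : c ≤ δ / 2) (N : ℕ) :
    OpDecay (fun y (b : PBond P j) => (Site.tdist y b.src : ℝ)) (fun b y => ∑ n ∈ range N, T n b y) c :=
  opDecay213_typed (dist := fun y (b : PBond P j) => (Site.tdist y b.src : ℝ)) hL hΛ hΛ1 hδ.le hA (fun _ _ => by positivity) hT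
    (fun b => sum_exp_neg_tdist_le' (half_pos hδ) b.src) hlow hhigh N


/-! ## 3. `Setup.KernelExpDecay` for multiscale families (v1.1, seat p08 gen 5)

The cell's own bond-kernel predicate `KernelExpDecay G C δ₀ s` (`|G(b,b′)| ≤ C e^{−δ₀·s·tdist(b₋,b′₋)}`, B4 Thm p. 573 / B5 Prop. 1.1 /
B9 Thm 3.1 shape) fed with the HIERARCHICAL families of (2.12)/(2.22): per-scale constants `(AΛⁿ, δ₀Lⁿ, s)` — *"The kernels of all these
operators have an exponential decay on their respective length scales"* (p. 262) — and the two printed regimes of the sum over scales: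
scaling factors `Λ < 1` (the propagator sums, (2.13): a `KernelExpDecay` kernel again, uniformly in the number of scales) and growing
scaling factors (the (2.16)/(2.23) regime: *"not well controlled for close points … For more distant points, however, the rapid decay of
terms with small j controls the scalings and the sum over j to yield a uniform bound"*), by `BIJ88MultiscaleDecay223` §1/§3. -/

/-- Dictionary with r18's one-letter shape: `KernelExpDecay G c c 1` (unit spacing, prefactor = rate = c) is (2.5)-shape
`BIJ88Sect2Statements.Decay` in the `ℓ¹` torus distance of the sources. [cite: BalabanImbrieJaffe1988, (2.5) p.260] -/
theorem kernelExpDecay_one_iff_decay {G : BondKernel P j} {c : ℝ} :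
    KernelExpDecay G c c 1 ↔ Decay (fun b b' : PBond P j => (Site.tdist b.src b'.src : ℝ)) G c := by
  simp only [KernelExpDecay, Decay, mul_one]

/-- Monotonicity in the constants: a larger prefactor and a slower rate (`δ₀′s′ ≤ δ₀s`) are again admissible.
[cite: BalabanImbrieJaffe1988, (2.13) p.261] -/
theorem kernelExpDecay_mono {G : BondKernel P j} {C C' δ₀ s δ₀' s' : ℝ} (h : KernelExpDecay G C δ₀ s) (hC : C ≤ C')
    (hrate : δ₀' * s' ≤ δ₀ * s) : KernelExpDecay G C' δ₀' s' := by
  intro b b'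
  have ht : (0 : ℝ) ≤ (Site.tdist b.src b'.src : ℝ) := by positivity
  have h0 := h b b'
  have hC0 : 0 ≤ C := by
    by_contra hneg
    have : C * Real.exp (-δ₀ * s * (Site.tdist b.src b'.src : ℝ)) < 0 :=
      mul_neg_of_neg_of_pos (lt_of_not_ge hneg) (Real.exp_pos _)
    linarith [abs_nonneg (G b b')]
  calc |G b b'| ≤ C * Real.exp (-δ₀ * s * (Site.tdist b.src b'.src : ℝ)) := h0
    _ ≤ C' * Real.exp (-δ₀ * s * (Site.tdist b.src b'.src : ℝ)) :=
        mul_le_mul_of_nonneg_right hC (Real.exp_pos _).le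
    _ ≤ C' * Real.exp (-δ₀' * s' * (Site.tdist b.src b'.src : ℝ)) := by
        refine mul_le_mul_of_nonneg_left (Real.exp_le_exp.2 ?_) (hC0.trans hC)
        nlinarith

/-- Sums of kernels with a common rate: the prefactors add (a finite family, e.g. the terms of (2.12) at ONE scale, or D_k plus the
rest in (2.22)). [cite: BalabanImbrieJaffe1988, (2.22) p.262] -/
theorem kernelExpDecay_sum {ι : Type*} (t : Finset ι) {G : ι → BondKernel P j} {C : ι → ℝ} {δ₀ s : ℝ}
    (h : ∀ i ∈ t, KernelExpDecay (G i) (C i) δ₀ s) :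
    KernelExpDecay (fun b b' => ∑ i ∈ t, G i b b') (∑ i ∈ t, C i) δ₀ s := by
  intro b b'
  calc |∑ i ∈ t, G i b b'| ≤ ∑ i ∈ t, |G i b b'| := Finset.abs_sum_le_sum_abs _ _
    _ ≤ ∑ i ∈ t, C i * Real.exp (-δ₀ * s * (Site.tdist b.src b'.src : ℝ)) := Finset.sum_le_sum fun i hi => h i hi b b'
    _ = (∑ i ∈ t, C i) * Real.exp (-δ₀ * s * (Site.tdist b.src b'.src : ℝ)) := by rw [Finset.sum_mul]

/-- Two kernels with a common rate. [cite: BalabanImbrieJaffe1988, (2.22) p.262] -/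
theorem kernelExpDecay_add {G₁ G₂ : BondKernel P j} {C₁ C₂ δ₀ s : ℝ} (h₁ : KernelExpDecay G₁ C₁ δ₀ s)
    (h₂ : KernelExpDecay G₂ C₂ δ₀ s) : KernelExpDecay (fun b b' => G₁ b b' + G₂ b b') (C₁ + C₂) δ₀ s := by
  intro b b'
  calc |G₁ b b' + G₂ b b'| ≤ |G₁ b b'| + |G₂ b b'| := abs_add_le _ _
    _ ≤ C₁ * Real.exp (-δ₀ * s * (Site.tdist b.src b'.src : ℝ)) + C₂ * Real.exp (-δ₀ * s * (Site.tdist b.src b'.src : ℝ)) :=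
        add_le_add (h₁ b b') (h₂ b b')
    _ = (C₁ + C₂) * Real.exp (-δ₀ * s * (Site.tdist b.src b'.src : ℝ)) := by ring

/-- **A hierarchical family with scaling factors `Λ < 1` sums to a `KernelExpDecay` kernel, uniformly in the number of scales**: per-scale
constants `(AΛⁿ, δ₀Lⁿ, s)` (the n-th term decays on the length scale `L^{−n}`), `L ≥ 1`, `0 ≤ Λ < 1`, `A ≥ 0`, `δ₀s ≥ 0` ⟹ for every `N` the sum
`Σ_{n<N} G_n` is `KernelExpDecay (A/(1−Λ)) δ₀ s` — the regime of the propagator sums (2.12)–(2.13), by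
`BIJ88MultiscaleDecay223.multiscale_sum_le_of_lt_one`. [cite: BalabanImbrieJaffe1988, (2.13) p.261] -/
theorem kernelExpDecay_multiscale {G : ℕ → BondKernel P j} {A Λ L δ₀ s : ℝ} (hL : 1 ≤ L) (hΛ : 0 ≤ Λ) (hΛ1 : Λ < 1)
    (hA : 0 ≤ A) (hδs : 0 ≤ δ₀ * s) (hG : ∀ n, KernelExpDecay (G n) (A * Λ ^ n) (δ₀ * L ^ n) s) (N : ℕ) :
    KernelExpDecay (fun b b' => ∑ n ∈ range N, G n b b') (A / (1 - Λ)) δ₀ s := by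
  intro b b'
  set t : ℝ := (Site.tdist b.src b'.src : ℝ) with ht
  have ht0 : 0 ≤ t := by rw [ht]; positivity
  have hT : ∀ n, |G n b b'| ≤ A * Λ ^ n * Real.exp (-(δ₀ * s * L ^ n) * t) := by
    intro n
    have h := hG n b b'
    have e : -(δ₀ * L ^ n) * s * t = -(δ₀ * s * L ^ n) * t := by ring
    rwa [← ht, e] at h
  have hsum := multiscale_sum_le_of_lt_one hL hΛ hΛ1 hδs N ht0
  calc |∑ n ∈ range N, G n b b'| ≤ ∑ n ∈ range N, |G n b b'| := Finset.abs_sum_le_sum_abs _ _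
    _ ≤ ∑ n ∈ range N, A * Λ ^ n * Real.exp (-(δ₀ * s * L ^ n) * t) := Finset.sum_le_sum fun n _ => hT n
    _ = A * ∑ n ∈ range N, Λ ^ n * Real.exp (-(δ₀ * s * L ^ n) * t) := by
        rw [Finset.mul_sum]; simp only [mul_assoc]
    _ ≤ A * (Real.exp (-(δ₀ * s) * t) / (1 - Λ)) := mul_le_mul_of_nonneg_left hsum hA
    _ = A / (1 - Λ) * Real.exp (-δ₀ * s * t) := by rw [neg_mul]; ring

/-- **Growing scaling factors: the uniform bound beyond a threshold** (the regime of (2.16)/(2.23)).  Per-scale constants `(AΛⁿ, δ₀Lⁿ, s)`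
with ANY `Λ ≥ 0`; if the one-step ratio at the threshold `d₀` satisfies `Λe^{−δ₀s(L−1)d₀} ≤ q < 1`, then for every `N` and every pair of bonds
with `tdist(b₋,b′₋) ≥ d₀`: `|Σ_{n<N} G_n(b,b′)| ≤ (A/(1−q))·e^{−δ₀s·tdist(b₋,b′₋)}` — *"the rapid decay of terms with small j controls the scalings and
the sum over j to yield a uniform bound"*; no such bound on the diagonal when `Λ ≥ 1` (`BIJ88MultiscaleDecay223.le_multiscale_sum_at_zero`).
[cite: BalabanImbrieJaffe1988, (2.23) p.262] -/
theorem abs_multiscale_le_far {G : ℕ → BondKernel P j} {A Λ L δ₀ s d₀ q : ℝ} (hL : 1 ≤ L) (hΛ : 0 ≤ Λ) (hA : 0 ≤ A)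
    (hδs : 0 ≤ δ₀ * s) (hd₀ : 0 ≤ d₀) (hq : Λ * Real.exp (-(δ₀ * s * (L - 1) * d₀)) ≤ q) (hq1 : q < 1)
    (hG : ∀ n, KernelExpDecay (G n) (A * Λ ^ n) (δ₀ * L ^ n) s) (N : ℕ) {b b' : PBond P j}
    (hfar : d₀ ≤ (Site.tdist b.src b'.src : ℝ)) :
    |∑ n ∈ range N, G n b b'| ≤ A / (1 - q) * Real.exp (-δ₀ * s * (Site.tdist b.src b'.src : ℝ)) := by
  have hT : ∀ n (x y : PBond P j), |G n x y| ≤ A * Λ ^ n * Real.exp (-(δ₀ * s * L ^ n) * (Site.tdist x.src y.src : ℝ)) := by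
    intro n x y
    have h := hG n x y
    have e : -(δ₀ * L ^ n) * s * (Site.tdist x.src y.src : ℝ) = -(δ₀ * s * L ^ n) * (Site.tdist x.src y.src : ℝ) := by ring
    rwa [e] at h
  have hq' : Λ * Real.exp (-(δ₀ * s * (L - 1) * d₀)) ≤ q := hq
  have h := abs_multiscaleKernel_le (dist := fun x y : PBond P j => (Site.tdist x.src y.src : ℝ)) (T := G) hL hΛ hδs hA hd₀
    hq' hq1 hT N b b' hfar
  rw [show -δ₀ * s * (Site.tdist b.src b'.src : ℝ) = -(δ₀ * s) * (Site.tdist b.src b'.src : ℝ) by ring]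
  exact h

end

end Literature.MathematicalPhysics.QuantumFieldTheory.BalabanImbrieJaffe1984to88.BIJ88MultiscaleDecay223Torus
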